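import Mathlib
import HarnessLib
import Literature.MathematicalPhysics.QuantumLattice.GaugeGroups
import Literature.MathematicalPhysics.QuantumFieldTheory.ConstructiveQFTWave0
import Literature.MathematicalPhysics.QuantumFieldTheory.GaussianToolkit
import Summits.Ventures.LatticeQCDFlow.Exactness.FlowPushforward
import Summits.Ventures.LatticeQCDFlow.Scaling.EntropyBudgetLayers

/-!
# LatticeQCDFlow / Scaling — the entropy budget of an exact flow, VI: coupling layers

HONEST FRAMING: exact (Metropolis-corrected) sampling algorithms for lattice gauge theory;
figures of merit are autocorrelation/cost numbers at stated couplings and volumes; no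
continuum-physics claim.

Venture `LatticeQCDFlow` (cell pub-lqcd), topic `Scaling`, THEORY-2.md §3.2 (h) / §4 rows T2-AG(m),
T2-AI(m) (theory seat GEN-10).  The last step of the flow dictionary left open in Part V
(`EntropyBudgetLayers`): the per-layer contraction clamp `K` of a COUPLING LAYER in terms of its
architecture.  A coupling layer on a product configuration space `ι → G` (links `ι`, group `G`,
reference `⊗ᵢ m`) freezes the links outside an ACTIVE set `{i // p i}` and updates each active
link by a single-link measurable bijection `ψ a (U|frozen) : G ≃ᵐ G` that depends only on the
frozen links and has an exact real Jacobian density `j a (U|frozen) (·) > 0` w.r.t. `m`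
(`Exactness.HasJacobian`; for a Lie group and a smooth `ψ` this is `|det dψ|` in exponential
coordinates — here it is the hypothesis an implementation certifies per link).  Then:

* `hasJacobian_pointwise` / `hasJacobian_couple` / `hasJacobian_conj` — products, fibrewise
  maps on `X × Y` (Tonelli), transport along `Ω ≃ᵐ Ω'`;
* `coupleFun`, `coupleJac`, `coupleEquiv` — the coupling layer on `ι → G`, its Jacobian
  `∏_{a active} j a (U|frozen) (U a)`, and the layer as a measurable equivalence (inverse = the
  coupling layer of the inverse bijections, the frozen part being unchanged);
* `hasJacobian_coupleFun` — **a coupling layer is exact with Jacobian `coupleJac`** (w.r.t.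
  `⊗ᵢ m`, `m` σ-finite);  `coupleJac_inv_le` — **per-link clamp `1/j ≤ e^ℓ` ⟹ layer clamp
  `1/J ≤ e^{ℓ·#active}`**;
* `Lattice.SU2.depth_lower_bound_coupling` — **THE ARCHITECTURE FORM OF THE DEPTH LAW** for
  `SU(2)` lattice gauge theory on `L^d` (Wilson action, fundamental representation, product Haar
  reference), UNCONDITIONAL: an exact sampler made of `n` coupling layers, each acting on at most
  `V_a` links with per-link clamp `ℓ ≥ 0`, pushing forward a prior of density `0 < r ≤ M`, can
  keep `ESS ≥ e^{−t}` only if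
  `n·ℓ·V_a + log M ≥ 3((d−1)L^d(1/2 − 1/L) − 1/2)·log β − c·L^d − t`
  — depth × per-link log-clamp × active volume must grow like `(3/2)(d−1)L^d·log β` (T4
  `ExactnessVsExpressivity`, `VolumeScalingOfTraining`, capacity half).

What is NOT formalised: the computation of `j` for a concrete smooth single-link map from the Haar
volume form (it enters as the hypothesis `HasJacobian (haarProbability G) (ψ a y) (ofReal ∘ j)`),
and gauge equivariance of the layer (irrelevant to the bound).  References as in Parts III–V.
-/

namespace Summit.Ventures.LatticeQCDFlow.Theory2

open MeasureTheory Summit.Ventures.LatticeQCDFlow.Exactness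
open Literature.MathematicalPhysics.QuantumFieldTheory
open scoped ENNReal

/-- **Pointwise layers**: on `E^ι` with reference `⊗ᵢ m`, independent coordinatewise maps `ψᵢ`
with exact Jacobians `Jᵢ` form a map with exact Jacobian `∏ᵢ Jᵢ(xᵢ)`. [folklore] -/
theorem hasJacobian_pointwise {ι : Type*} [Fintype ι] {E : Type*} [MeasurableSpace E]
    (m : Measure E) [SigmaFinite m] {ψ : ι → E → E} {J : ι → E → ℝ≥0∞}
    (h : ∀ i, HasJacobian m (ψ i) (J i)) (hJtop : ∀ i x, J i x ≠ ∞) :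
    HasJacobian (Measure.pi fun _ : ι => m) (fun x i => ψ i (x i)) fun x => ∏ i, J i (x i) := by
  haveI : ∀ i : ι, SigmaFinite (m.withDensity (J i)) := fun i =>
    SigmaFinite.withDensity_of_ne_top' (hJtop i)
  haveI : ∀ i : ι, SigmaFinite ((m.withDensity (J i)).map (ψ i)) := fun i => by
    rw [(h i).map_eq]; infer_instance
  refine ⟨measurable_pi_lambda _ fun i => (h i).measurable.comp (measurable_pi_apply i),
    Finset.measurable_prod _ fun i _ => (h i).measurable_jac.comp (measurable_pi_apply i), ?_⟩
  rw [← GaussianToolkit.pi_withDensity (fun _ : ι => m) J fun i => (h i).measurable_jac,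
    Measure.pi_map_pi fun i => (h i).measurable.aemeasurable]
  exact congrArg Measure.pi (funext fun i => (h i).map_eq)

/-- **Coupling**: on `X × Y` (active × frozen, reference `μ ⊗ ν`), `(x, y) ↦ (T_y x, y)` with
`T_y` exact w.r.t. `μ` with Jacobian `J(·, y)` for EVERY `y` (jointly measurable) is exact
w.r.t. `μ ⊗ ν` with Jacobian `J` (Tonelli). [folklore] -/
theorem hasJacobian_couple {X Y : Type*} [MeasurableSpace X] [MeasurableSpace Y]
    (μ : Measure X) (ν : Measure Y) [SigmaFinite μ] [SigmaFinite ν]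
    {T : Y → X → X} {J : X × Y → ℝ≥0∞} (hT : Measurable fun p : X × Y => T p.2 p.1)
    (hJ : Measurable J) (hfib : ∀ y, Measure.map (T y) (μ.withDensity fun x => J (x, y)) = μ) :
    HasJacobian (μ.prod ν) (fun p : X × Y => (T p.2 p.1, p.2)) J := by
  have hF : Measurable fun p : X × Y => (T p.2 p.1, p.2) := hT.prodMk measurable_snd
  refine ⟨hF, hJ, ?_⟩
  symm
  refine Measure.prod_eq fun s t hs ht => ?_
  have hTy : ∀ y, Measurable (T y) := fun y => hT.comp (measurable_id.prodMk measurable_const)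
  have hJy : ∀ y, Measurable fun x => J (x, y) := fun y =>
    hJ.comp (measurable_id.prodMk measurable_const)
  rw [Measure.map_apply hF (hs.prod ht), withDensity_apply _ (hF (hs.prod ht)),
    ← lintegral_indicator (hF (hs.prod ht))]
  have hind : (fun p : X × Y => ((fun p : X × Y => (T p.2 p.1, p.2)) ⁻¹' s ×ˢ t).indicator J p) =
      fun p : X × Y => t.indicator (fun _ => (1 : ℝ≥0∞)) p.2 *
        (J p * s.indicator (1 : X → ℝ≥0∞) (T p.2 p.1)) := by
    funext p
    by_cases h1 : T p.2 p.1 ∈ s <;> by_cases h2 : p.2 ∈ t <;> simp [Set.indicator, h1, h2]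
  have hmeas : Measurable fun p : X × Y =>
      t.indicator (fun _ => (1 : ℝ≥0∞)) p.2 * (J p * s.indicator (1 : X → ℝ≥0∞) (T p.2 p.1)) :=
    ((measurable_const.indicator ht).comp measurable_snd).mul
      (hJ.mul ((measurable_one.indicator hs).comp hT))
  rw [hind, lintegral_prod_symm' _ hmeas]
  have hinner : ∀ y, ∫⁻ x, t.indicator (fun _ => (1 : ℝ≥0∞)) y *
      (J (x, y) * s.indicator (1 : X → ℝ≥0∞) (T y x)) ∂μ = t.indicator (fun _ => μ s) y := by
    intro y
    have hg : Measurable fun x => s.indicator (1 : X → ℝ≥0∞) (T y x) :=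
      (measurable_one.indicator hs).comp (hTy y)
    have hJg : Measurable fun x => J (x, y) * s.indicator (1 : X → ℝ≥0∞) (T y x) :=
      (hJy y).mul hg
    rw [lintegral_const_mul _ hJg]
    have hkey : ∫⁻ x, J (x, y) * s.indicator (1 : X → ℝ≥0∞) (T y x) ∂μ = μ s := by
      have h1 := lintegral_withDensity_eq_lintegral_mul μ (hJy y) hg
      have h2 := lintegral_map (μ := μ.withDensity fun x => J (x, y))
        (measurable_one.indicator hs) (hTy y)
      rw [hfib y, lintegral_indicator_one hs] at h2
      simp only [Pi.mul_apply] at h1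
      rw [← h1]
      exact h2.symm
    rw [hkey]
    by_cases hy : y ∈ t <;> simp [Set.indicator, hy]
  simp_rw [hinner]
  rw [lintegral_indicator_const ht]

/-- **Transport**: if `e : Ω ≃ᵐ Ω'` maps `vol` to `vol'` and `F'` is exact w.r.t. `vol'` with
Jacobian `J'`, then `e⁻¹ ∘ F' ∘ e` is exact w.r.t. `vol` with Jacobian `J' ∘ e`. [folklore] -/
theorem hasJacobian_conj {Ω Ω' : Type*} [MeasurableSpace Ω] [MeasurableSpace Ω']
    {vol : Measure Ω} {vol' : Measure Ω'} (e : Ω ≃ᵐ Ω') (he : Measure.map e vol = vol')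
    {F' : Ω' → Ω'} {J' : Ω' → ℝ≥0∞} (h : HasJacobian vol' F' J') :
    HasJacobian vol (e.symm ∘ F' ∘ e) (J' ∘ e) := by
  refine ⟨e.symm.measurable.comp (h.measurable.comp e.measurable),
    h.measurable_jac.comp e.measurable, ?_⟩
  have h1 : Measure.map e (vol.withDensity (J' ∘ e)) = vol'.withDensity J' := by
    rw [GaussianToolkit.map_withDensity_equiv e vol (J' ∘ e), he]
    congr 1
    funext x
    simp
  rw [← Measure.map_map e.symm.measurable (h.measurable.comp e.measurable),
    ← Measure.map_map h.measurable e.measurable, h1, h.map_eq, ← he, MeasurableEquiv.map_symm_map]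

/-! ## Coupling layers on a product of identical factors `ι → G` (active predicate `p`) -/

section Couple

variable {ι : Type*} (p : ι → Prop) [DecidablePred p] {G : Type*}

/-- A COUPLING LAYER on `ι → G`: the ACTIVE coordinates `{i // p i}` are updated one by one,
`U i ↦ ψ ⟨i, _⟩ (U|frozen) (U i)`, by single-coordinate maps depending only on the FROZEN
coordinates `{i // ¬ p i}`, which are left unchanged. -/
def coupleFun (ψ : {i // p i} → ({i // ¬p i} → G) → G → G) (U : ι → G) : ι → G :=
  fun i => if h : p i then ψ ⟨i, h⟩ (fun f => U f) (U i) else U i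

variable {p}

/-- A coupling layer leaves the frozen coordinates unchanged. -/
theorem coupleFun_frozen (ψ : {i // p i} → ({i // ¬p i} → G) → G → G) (U : ι → G) :
    (fun f : {i // ¬p i} => coupleFun p ψ U f) = fun f : {i // ¬p i} => U f := by
  funext f
  simp [coupleFun, f.2]

/-- Value of a coupling layer on an active coordinate. -/
theorem coupleFun_apply_of_pos (ψ : {i // p i} → ({i // ¬p i} → G) → G → G) (U : ι → G)
    {i : ι} (h : p i) : coupleFun p ψ U i = ψ ⟨i, h⟩ (fun f => U f) (U i) := by
  simp [coupleFun, h]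

/-- Value of a coupling layer on a frozen coordinate. -/
theorem coupleFun_apply_of_neg (ψ : {i // p i} → ({i // ¬p i} → G) → G → G) (U : ι → G)
    {i : ι} (h : ¬p i) : coupleFun p ψ U i = U i := by
  simp [coupleFun, h]

variable (p) [Fintype ι]

/-- The Jacobian density of a coupling layer: the product over the active coordinates of the
single-coordinate Jacobians (evaluated at the frozen part). -/
def coupleJac (j : {i // p i} → ({i // ¬p i} → G) → G → ℝ) (U : ι → G) : ℝ :=
  ∏ a, j a (fun f => U f) (U a)

variable {p}

/-- The coupling-layer Jacobian is positive. -/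
theorem coupleJac_pos {j : {i // p i} → ({i // ¬p i} → G) → G → ℝ}
    (hj0 : ∀ a y g, 0 < j a y g) (U : ι → G) : 0 < coupleJac p j U :=
  Finset.prod_pos fun a _ => hj0 a _ _

/-- **Per-link clamp ⟹ layer clamp.**  If every single-coordinate Jacobian satisfies
`1/j ≤ e^ℓ`, the coupling layer satisfies `1/J ≤ e^{ℓ · #active}`. -/
theorem coupleJac_inv_le {j : {i // p i} → ({i // ¬p i} → G) → G → ℝ} {ℓ : ℝ}
    (hj0 : ∀ a y g, 0 < j a y g) (hjl : ∀ a y g, (j a y g)⁻¹ ≤ Real.exp ℓ) (U : ι → G) :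
    (coupleJac p j U)⁻¹ ≤ Real.exp (ℓ * Fintype.card {i // p i}) := by
  unfold coupleJac
  rw [← Finset.prod_inv_distrib, mul_comm, Real.exp_nat_mul, ← Finset.card_univ,
    ← Finset.prod_const]
  exact Finset.prod_le_prod (fun a _ => (inv_pos.mpr (hj0 a _ _)).le) fun a _ => hjl a _ _

variable [MeasurableSpace G]

omit [Fintype ι] in
/-- A coupling layer is the conjugate, under the split `(ι → G) ≃ (active) × (frozen)`, of a
fibrewise pointwise map. -/
theorem coupleFun_eq_conj (ψ : {i // p i} → ({i // ¬p i} → G) → G → G) :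
    coupleFun p ψ = (MeasurableEquiv.piEquivPiSubtypeProd (fun _ : ι => G) p).symm ∘
      (fun q : ({i // p i} → G) × ({i // ¬p i} → G) => (fun a => ψ a q.2 (q.1 a), q.2)) ∘
      (MeasurableEquiv.piEquivPiSubtypeProd (fun _ : ι => G) p) := by
  funext U i
  by_cases h : p i
  · simp [coupleFun, h, MeasurableEquiv.piEquivPiSubtypeProd]
  · simp [coupleFun, h, MeasurableEquiv.piEquivPiSubtypeProd]

omit [DecidablePred p] [Fintype ι] in
/-- Measurability of `U ↦ (U a, U|frozen)`. -/
theorem measurable_activeFrozen (a : {i // p i}) :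
    Measurable fun U : ι → G => (U a, fun f : {i // ¬p i} => U f) :=
  (measurable_pi_apply (a : ι)).prodMk (measurable_pi_lambda _ fun _ => measurable_pi_apply _)

omit [Fintype ι] in
/-- A coupling layer is measurable when its single-coordinate maps are jointly measurable in
(coordinate, frozen part). -/
theorem measurable_coupleFun {ψ : {i // p i} → ({i // ¬p i} → G) → G → G}
    (hψ : ∀ a, Measurable fun q : G × ({i // ¬p i} → G) => ψ a q.2 q.1) :
    Measurable (coupleFun p ψ) := by
  refine measurable_pi_lambda _ fun i => ?_
  by_cases h : p i
  · have heq : (fun U : ι → G => coupleFun p ψ U i) =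
        (fun q : G × ({i // ¬p i} → G) => ψ ⟨i, h⟩ q.2 q.1) ∘
          fun U : ι → G => (U i, fun f : {i // ¬p i} => U f) := by
      funext U
      simp [coupleFun, h]
    rw [heq]
    exact (hψ ⟨i, h⟩).comp (measurable_activeFrozen ⟨i, h⟩)
  · have heq : (fun U : ι → G => coupleFun p ψ U i) = fun U => U i := by
      funext U
      simp [coupleFun, h]
    rw [heq]
    exact measurable_pi_apply i

omit [Fintype ι] in
/-- The coupling layer of the inverse single-coordinate bijections inverts the coupling layer
(the frozen part, on which the bijections depend, is unchanged). -/
theorem coupleFun_symm_apply_apply (ψ : {i // p i} → ({i // ¬p i} → G) → G ≃ᵐ G)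
    (U : ι → G) :
    coupleFun p (fun a y g => (ψ a y).symm g) (coupleFun p (fun a y g => ψ a y g) U) = U := by
  funext i
  by_cases h : p i
  · rw [coupleFun_apply_of_pos _ _ h, coupleFun_frozen, coupleFun_apply_of_pos _ _ h]
    exact (ψ _ _).symm_apply_apply _
  · rw [coupleFun_apply_of_neg _ _ h, coupleFun_apply_of_neg _ _ h]

omit [Fintype ι] in
/-- **Coupling layers are measurable bijections.**  The coupling layer built from
single-coordinate measurable bijections `ψ a y : G ≃ᵐ G` (jointly measurable, with jointly
measurable inverses) as a measurable equivalence of `ι → G`. -/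
def coupleEquiv (ψ : {i // p i} → ({i // ¬p i} → G) → G ≃ᵐ G)
    (hψ : ∀ a, Measurable fun q : G × ({i // ¬p i} → G) => ψ a q.2 q.1)
    (hψs : ∀ a, Measurable fun q : G × ({i // ¬p i} → G) => (ψ a q.2).symm q.1) :
    (ι → G) ≃ᵐ (ι → G) where
  toFun := coupleFun p fun a y g => ψ a y g
  invFun := coupleFun p fun a y g => (ψ a y).symm g
  left_inv U := coupleFun_symm_apply_apply ψ U
  right_inv U := by
    simpa only [MeasurableEquiv.symm_symm] using
      coupleFun_symm_apply_apply (fun a y => (ψ a y).symm) U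
  measurable_toFun := by
    change Measurable (coupleFun p fun a y g => ψ a y g)
    exact measurable_coupleFun hψ
  measurable_invFun := by
    change Measurable (coupleFun p fun a y g => (ψ a y).symm g)
    exact measurable_coupleFun hψs

omit [Fintype ι] in
/-- The underlying map of `coupleEquiv` is the coupling layer. -/
@[simp] theorem coe_coupleEquiv (ψ : {i // p i} → ({i // ¬p i} → G) → G ≃ᵐ G)
    (hψ : ∀ a, Measurable fun q : G × ({i // ¬p i} → G) => ψ a q.2 q.1)
    (hψs : ∀ a, Measurable fun q : G × ({i // ¬p i} → G) => (ψ a q.2).symm q.1) :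
    ⇑(coupleEquiv ψ hψ hψs) = coupleFun p fun a y g => ψ a y g := rfl

/-- The coupling-layer Jacobian is measurable. -/
theorem measurable_coupleJac {j : {i // p i} → ({i // ¬p i} → G) → G → ℝ}
    (hj : ∀ a, Measurable fun q : G × ({i // ¬p i} → G) => j a q.2 q.1) :
    Measurable (coupleJac p j) :=
  Finset.measurable_prod _ fun a _ => (hj a).comp (measurable_activeFrozen a)

/-- **A coupling layer has exact Jacobian = the product of its single-coordinate Jacobians.**
Reference `⊗ᵢ m` (`m` σ-finite); for every active `a` and frozen configuration `y` the map
`ψ a y` has exact Jacobian `ofReal ∘ j a y` w.r.t. `m`, jointly measurably in `(g, y)`.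
[folklore] -/
theorem hasJacobian_coupleFun (m : Measure G) [SigmaFinite m]
    {ψ : {i // p i} → ({i // ¬p i} → G) → G → G} {j : {i // p i} → ({i // ¬p i} → G) → G → ℝ}
    (hψ : ∀ a, Measurable fun q : G × ({i // ¬p i} → G) => ψ a q.2 q.1)
    (hj : ∀ a, Measurable fun q : G × ({i // ¬p i} → G) => j a q.2 q.1)
    (hJ : ∀ a y, HasJacobian m (ψ a y) fun g => ENNReal.ofReal (j a y g))
    (hj0 : ∀ a y g, 0 ≤ j a y g) :
    HasJacobian (Measure.pi fun _ : ι => m) (coupleFun p ψ)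
      fun U => ENNReal.ofReal (coupleJac p j U) := by
  set e := MeasurableEquiv.piEquivPiSubtypeProd (fun _ : ι => G) p with he_def
  have he : Measure.map e (Measure.pi fun _ : ι => m) =
      (Measure.pi fun _ : {i // p i} => m).prod (Measure.pi fun _ : {i // ¬p i} => m) :=
    (measurePreserving_piEquivPiSubtypeProd (fun _ : ι => m) p).map_eq
  have hproj : ∀ a : {i // p i},
      Measurable fun q : ({i // p i} → G) × ({i // ¬p i} → G) => (q.1 a, q.2) :=
    fun a => ((measurable_pi_apply a).comp measurable_fst).prodMk measurable_snd
  have hT : Measurable fun q : ({i // p i} → G) × ({i // ¬p i} → G) =>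
      (fun a => ψ a q.2 (q.1 a)) :=
    measurable_pi_lambda _ fun a => (hψ a).comp (hproj a)
  have hJa : ∀ a : {i // p i}, Measurable fun q : ({i // p i} → G) × ({i // ¬p i} → G) =>
      ENNReal.ofReal (j a q.2 (q.1 a)) :=
    fun a => ENNReal.measurable_ofReal.comp ((hj a).comp (hproj a))
  have hJm : Measurable fun q : ({i // p i} → G) × ({i // ¬p i} → G) =>
      ∏ a, ENNReal.ofReal (j a q.2 (q.1 a)) :=
    Finset.measurable_prod _ fun a _ => hJa a
  have hfib : ∀ y : {i // ¬p i} → G, Measure.map (fun x : {i // p i} → G => fun a => ψ a y (x a))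
      ((Measure.pi fun _ : {i // p i} => m).withDensity
        fun x => ∏ a, ENNReal.ofReal (j a y (x a))) = Measure.pi fun _ : {i // p i} => m :=
    fun y => (hasJacobian_pointwise m (fun a => hJ a y) fun a g => ENNReal.ofReal_ne_top).map_eq
  have hc := hasJacobian_couple (Measure.pi fun _ : {i // p i} => m)
    (Measure.pi fun _ : {i // ¬p i} => m) hT hJm hfib
  have hconj := hasJacobian_conj e he hc
  have hJU : ∀ a : {i // p i}, Measurable fun U : ι → G => j a (fun f => U f) (U a) :=
    fun a => (hj a).comp (measurable_activeFrozen a)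
  rw [coupleFun_eq_conj ψ]
  refine ⟨hconj.measurable, ENNReal.measurable_ofReal.comp (Finset.measurable_prod _
    fun a _ => hJU a), ?_⟩
  have hfun : (fun U : ι → G => ENNReal.ofReal (coupleJac p j U)) =
      (fun q : ({i // p i} → G) × ({i // ¬p i} → G) =>
        ∏ a, ENNReal.ofReal (j a q.2 (q.1 a))) ∘ e := by
    funext U
    simp only [coupleJac, Function.comp_apply]
    rw [ENNReal.ofReal_prod_of_nonneg fun a _ => hj0 a _ _]
    rfl
  rw [hfun]
  exact hconj.map_eq

end Couple

end Summit.Ventures.LatticeQCDFlow.Theory2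

namespace Summit.Ventures.LatticeQCDFlow.Theory2.Lattice

open MeasureTheory Summit.Ventures.LatticeQCDFlow.Exactness
open Literature.MathematicalPhysics.QuantumLattice Literature.MathematicalPhysics.QuantumFieldTheory
open scoped ENNReal

/-- **The depth law in architecture form, `SU(2)`, UNCONDITIONAL.**  For every `d` there is `c`
such that for all `L ≥ 2`, `β ≥ 1`: an exact sampler for `SU(2)` Wilson lattice gauge theory on
`L^d` consisting of `n` coupling layers (layer `k` active on the links `P k`, at most `V_a` of
them, single-link bijections `Ψ k a (frozen)` with exact Haar-Jacobians `Jf k a (frozen) (·) > 0`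
obeying the per-link clamp `1/Jf ≤ e^ℓ`, `ℓ ≥ 0`), applied to a prior of density `0 < r ≤ M`
w.r.t. product Haar, keeps `ESS ≥ e^{−t}` against the Wilson measure only if
`3((d−1)L^d(1/2 − 1/L) − 1/2)·log β − c·L^d − t ≤ n·(ℓ·V_a) + log M`. [folklore] -/
theorem SU2.depth_lower_bound_coupling (d : ℕ) :
    ∃ c : ℝ, ∀ (L : ℕ) [NeZero L], 2 ≤ L → ∀ β : ℝ, 1 ≤ β →
      ∀ (n : ℕ) (P : Fin n → Edge d L → Prop) [∀ k, DecidablePred (P k)]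
        (Ψ : (k : Fin n) → {e // P k e} → ({e // ¬P k e} → Matrix.specialUnitaryGroup (Fin 2) ℂ) →
          Matrix.specialUnitaryGroup (Fin 2) ℂ ≃ᵐ Matrix.specialUnitaryGroup (Fin 2) ℂ)
        (Jf : (k : Fin n) → {e // P k e} → ({e // ¬P k e} → Matrix.specialUnitaryGroup (Fin 2) ℂ) →
          Matrix.specialUnitaryGroup (Fin 2) ℂ → ℝ)
        (hΨ : ∀ k a, Measurable fun q : Matrix.specialUnitaryGroup (Fin 2) ℂ ×
          ({e // ¬P k e} → Matrix.specialUnitaryGroup (Fin 2) ℂ) => Ψ k a q.2 q.1)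
        (hΨs : ∀ k a, Measurable fun q : Matrix.specialUnitaryGroup (Fin 2) ℂ ×
          ({e // ¬P k e} → Matrix.specialUnitaryGroup (Fin 2) ℂ) => (Ψ k a q.2).symm q.1)
        (r : GaugeConfig d L (Matrix.specialUnitaryGroup (Fin 2) ℂ) → ℝ) (ℓ Va M t : ℝ),
        (∀ k a, Measurable fun q : Matrix.specialUnitaryGroup (Fin 2) ℂ ×
          ({e // ¬P k e} → Matrix.specialUnitaryGroup (Fin 2) ℂ) => Jf k a q.2 q.1) →
        (∀ k a y, HasJacobian (haarProbability (Matrix.specialUnitaryGroup (Fin 2) ℂ)) (Ψ k a y)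
          fun g => ENNReal.ofReal (Jf k a y g)) →
        (∀ k a y g, 0 < Jf k a y g) → (∀ k a y g, (Jf k a y g)⁻¹ ≤ Real.exp ℓ) → 0 ≤ ℓ →
        (∀ k, (Fintype.card {e // P k e} : ℝ) ≤ Va) →
        Measurable r → (∀ V, 0 < r V) → (∀ V, r V ≤ M) →
          Real.exp (-t) ≤ essM (wilsonMeasure (d := d) (L := L) (fundamentalRep (Fin 2)) β)
              (Measure.map (layersEquiv (List.ofFn fun k =>
                  (coupleEquiv (Ψ k) (hΨ k) (hΨs k), coupleJac (P k) (Jf k))))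
                ((Measure.pi fun _ : Edge d L =>
                  haarProbability (Matrix.specialUnitaryGroup (Fin 2) ℂ)).withDensity
                  fun V => ENNReal.ofReal (r V))) →
            3 * (((d : ℝ) - 1) * (L : ℝ) ^ d * (1 / 2 - 1 / L) - 1 / 2) * Real.log β -
                c * (L : ℝ) ^ d - t ≤ (n : ℝ) * (ℓ * Va) + Real.log M := by
  obtain ⟨c, hc⟩ := SU2.depth_lower_bound_two d
  refine ⟨c, fun L _ hL β hβ n P _ Ψ Jf hΨ hΨs r ℓ Va M t hJf hJ h0 hl hℓ hVa hr hr0 hrM hess => ?_⟩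
  set ls := List.ofFn fun k => (coupleEquiv (Ψ k) (hΨ k) (hΨs k), coupleJac (P k) (Jf k))
    with hls
  have hK0 : 0 < Real.exp (ℓ * Va) := Real.exp_pos _
  have h1 : ∀ l ∈ ls, HasJacobian (Measure.pi fun _ : Edge d L =>
      haarProbability (Matrix.specialUnitaryGroup (Fin 2) ℂ)) l.1
      fun V => ENNReal.ofReal (l.2 V) := by
    rw [hls, List.forall_mem_ofFn_iff]
    intro k
    simp only [coe_coupleEquiv]
    exact hasJacobian_coupleFun (ψ := fun a y g => Ψ k a y g)
      (haarProbability (Matrix.specialUnitaryGroup (Fin 2) ℂ)) (hΨ k) (hJf k) (hJ k)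
      fun a y g => (h0 k a y g).le
  have h2 : ∀ l ∈ ls, Measurable l.2 := by
    rw [hls, List.forall_mem_ofFn_iff]
    intro k
    exact measurable_coupleJac (hJf k)
  have h3 : ∀ l ∈ ls, ∀ V, 0 < l.2 V := by
    rw [hls, List.forall_mem_ofFn_iff]
    intro k V
    exact coupleJac_pos (h0 k) V
  have h4 : ∀ l ∈ ls, ∀ V, (l.2 V)⁻¹ ≤ Real.exp (ℓ * Va) := by
    rw [hls, List.forall_mem_ofFn_iff]
    intro k V
    exact (coupleJac_inv_le (h0 k) (hl k) V).trans
      (Real.exp_le_exp.mpr (mul_le_mul_of_nonneg_left (hVa k) hℓ))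
  have hmain := hc L hL β hβ ls r (Real.exp (ℓ * Va)) M t h1 h2 h3 h4 hK0 hr hr0 hrM hess
  simpa only [hls, List.length_ofFn, Real.log_exp] using hmain

end Summit.Ventures.LatticeQCDFlow.Theory2.Lattice
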